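import Summits.BirchSwinnertonDyer.BirchSwinnertonDyer.Theorems.KatoDescentPotSupersingularReducibleUpperOfCountInputsNodes
import Literature.NumberTheory.EllipticCurves.Kato2004.IwasawaCohomologyExistsProofs
import HarnessLib

/-!
# Cell `bsd-potss`, routes K9 `KatoDescentPotSupersingular` / K8-t′ `KatoDescentTamePotSupersingular`:
# the reducible-row nodes WITHOUT the input `nonempty_iwasawaH1Data` (now a theorem) — ROUTE-FREE
# module (imports no `Theses.*` file): crux M from TWO named facts, U₀-red from FIVE

Seat `bsd-potss-rkm` (prover, generation 4; items stmt-BirchSwinnertonDyer-19196 `ReducibleKatoMember`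
(crux M, shared K9/KT) and the U₀-red family 19190 / 19203).  The route-free node theorems of
`KatoDescentPotSupersingularReducibleKatoMemberNodes.lean` (rkm g3 / kmc g9:
`nonempty_iwasawaH1Data → exists_isNewformOf → exists_memberHullInputs → O6.KatoMemberShaBoundOfReducible`)
and `KatoDescentPotSupersingularReducibleUpperOfCountInputsNodes.lean` (kmc g9 PART 16: the bodies of
`WildUpperReducibleDefect` / `TameUpperReducibleDefect` from six inputs) take Kato's construction fact
`Kato2004.nonempty_iwasawaH1Data` as their FIRST hypothesis.  That fact is PROVED
(`Kato2004.nonempty_iwasawaH1Data_holds`, `Literature/…/Kato2004/IwasawaCohomologyExistsProofs.lean`,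
p464347: the `Λ`-module `𝐇¹_Γ(T_pW)` built on the norm-compatible integral families by Weierstrass
division), so this file records the SAME nodes with that hypothesis discharged:

* `katoMemberShaBoundOfReducible_of_newform_of_memberHullInputs :
    exists_isNewformOf → exists_memberHullInputs → O6.KatoMemberShaBoundOfReducible` — crux M's node now
  rests on EXACTLY TWO named inputs: modularity and Kato §§12–14 + Wuthrich L.14 at the member
  (`Kato2004.exists_memberHullInputs`, the referee-flagged transcription); `_of_and` = conjunction form;
* `wildUpperReducibleDefect_body₅` / `tameUpperReducibleDefect_body₅` — the U₀-red bodies from the FIVE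
  remaining inputs (modularity, the COUNT fact `exists_memberHullCountInputs`, Cassels' isogeny
  invariance `bsdRHS_eq_of_isIsogenous`, `rank = analytic rank ≤ 1`, entire `L`-function);
* `missingUpperBoundAt_of_memberCountInputs₅` — the per-row form.

Nothing new is proved about elliptic curves: each theorem is the existing node applied to
`nonempty_iwasawaH1Data_holds`.  CONDITIONAL on the remaining named facts (audit `proof.conditional`);
no item is closed by this file (the items' glues 19660/19661/19711/19712 are already closed and keep
their typed first hypothesis, now dischargeable by name).  HONEST FRAMING: BSD is not advanced; the
open mathematics of M / U₀-red (Kato's Euler-system bound at an additive reducible prime) is unchanged.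

References: [Kato2004Asterisque] §12.2 (12.2.1) (p. 220), Thm. 12.6 (p. 222), §14.14–14.16
(pp. 243–245); [Wuthrich2014] Lemma 14; [Cassels1965ArithmeticVIII].
-/

set_option autoImplicit false
-- sibling precedent: the directory name repeats the summit name
set_option linter.dupNamespace false

noncomputable section

namespace Summit.BirchSwinnertonDyer.BirchSwinnertonDyer.Theorems.ReducibleOfTwoInputs

open WeierstrassCurve Literature.NumberTheory.EllipticCurves
  Literature.NumberTheory.EllipticCurves.ModularForms
  Literature.NumberTheory.EllipticCurves.Kato2004
  Literature.NumberTheory.EllipticCurves.Rank1Residual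
  Literature.NumberTheory.EllipticCurves.Rank1Residual.Typed
  Summit.BirchSwinnertonDyer.Rank1Residual.Additive
  Summit.BirchSwinnertonDyer.Rank1Residual

/-- **Crux M's node from TWO named facts**: `exists_isNewformOf → exists_memberHullInputs →
O6.KatoMemberShaBoundOfReducible` (the three-input node of
`ReducibleKatoMemberOfInputs.katoMemberShaBoundOfReducible_of_memberHullInputs` with its first input
discharged by `nonempty_iwasawaH1Data_holds`).  Conditional on the two named facts.
[cite: Kato2004Asterisque, §12.2 (12.2.1) (p. 220), Thm. 12.6 (p. 222), Prop. 14.16 (2) (p. 244)]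
[cite: Wuthrich2014, Lemma 14 (p. 396)] -/
theorem katoMemberShaBoundOfReducible_of_newform_of_memberHullInputs (hmod : exists_isNewformOf)
    (hin : Kato2004.exists_memberHullInputs) :
    Summit.BirchSwinnertonDyer.Rank1Residual.O6.KatoMemberShaBoundOfReducible :=
  ReducibleKatoMemberOfInputs.katoMemberShaBoundOfReducible_of_memberHullInputs
    nonempty_iwasawaH1Data_holds hmod hin

/-- Conjunction form of the two-input node: `(exists_isNewformOf ∧ exists_memberHullInputs) →
O6.KatoMemberShaBoundOfReducible`. [cite: Kato2004Asterisque, Thm. 12.6 (p. 222), Prop. 14.16 (2) (p. 244)] -/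
theorem katoMemberShaBoundOfReducible_of_and
    (h : exists_isNewformOf ∧ Kato2004.exists_memberHullInputs) :
    Summit.BirchSwinnertonDyer.Rank1Residual.O6.KatoMemberShaBoundOfReducible :=
  katoMemberShaBoundOfReducible_of_newform_of_memberHullInputs h.1 h.2

/-- **Upper half on a reducible additive potentially good row of analytic rank `0` from FIVE inputs**
(`ReducibleUpperOfCountInputs.missingUpperBoundAt_of_memberCountInputs` with `nonempty_iwasawaH1Data`
discharged). Conditional on the five named facts.
[cite: Kato2004Asterisque, proof of Prop. 14.16 (pp. 244–245), §14.14 (p. 243)] [cite: Cassels1965ArithmeticVIII] -/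
theorem missingUpperBoundAt_of_memberCountInputs₅ (hmod : exists_isNewformOf)
    (hin : Kato2004.exists_memberHullCountInputs) (hCassels : bsdRHS_eq_of_isIsogenous)
    (hGZK : rank_eq_analyticRank_of_analyticRank_le_one) (hmodL : hasEntireLFunction_rat)
    (W : WeierstrassCurve ℚ) [W.IsElliptic] [W.IsGloballyMinimal] (p : ℕ) [Fact p.Prime]
    (hp : p ≠ 2) (hng : ¬ W.HasGoodReductionAtPrime p) (hnm : ¬ W.HasMultiplicativeReductionAtPrime p)
    (hj : 0 ≤ padicValRat p W.j) (hred : ¬ W.HasIrreducibleModPGaloisRep p)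
    (hr : W.analyticRank = 0) : MissingUpperBoundAt W p :=
  ReducibleUpperOfCountInputs.missingUpperBoundAt_of_memberCountInputs nonempty_iwasawaH1Data_holds
    hmod hin hCassels hGZK hmodL W p hp hng hnm hj hred hr

/-- **BODY of the K9 item `WildUpperReducibleDefect` (19190) from FIVE inputs** (kmc g9's
`wildUpperReducibleDefect_body` with `nonempty_iwasawaH1Data` discharged). Conditional; route-free.
[cite: Kato2004Asterisque, proof of Prop. 14.16 (pp. 244–245), §14.14 (p. 243)] [cite: Cassels1965ArithmeticVIII] -/
theorem wildUpperReducibleDefect_body₅ (hmod : exists_isNewformOf)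
    (hin : Kato2004.exists_memberHullCountInputs) (hCassels : bsdRHS_eq_of_isIsogenous)
    (hGZK : rank_eq_analyticRank_of_analyticRank_le_one) (hmodL : hasEntireLFunction_rat) :
    ∀ (W : WeierstrassCurve ℚ) [W.IsElliptic] [W.IsGloballyMinimal] [Fact (3 : ℕ).Prime],
      W.analyticRank = 0 → ClassO6 W 3 → ¬ W.HasIrreducibleModPGaloisRep 3 →
      ¬ ((∀ (W' : WeierstrassCurve ℚ) [W'.IsElliptic], IsIsogenous W W' → ¬ 3 ^ 2 ∣ W'.torsionOrder) ∧
          ∀ q : ℚ, shaAn W = (q : ℂ) → Even (padicValRat 3 q)) →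
      MissingUpperBoundAt W 3 :=
  ReducibleUpperOfCountInputs.wildUpperReducibleDefect_body nonempty_iwasawaH1Data_holds hmod hin
    hCassels hGZK hmodL

/-- **BODY of the K8-t′ item `TameUpperReducibleDefect` (19203) from FIVE inputs** (kmc g9's
`tameUpperReducibleDefect_body` with `nonempty_iwasawaH1Data` discharged). Conditional; route-free.
[cite: Kato2004Asterisque, proof of Prop. 14.16 (pp. 244–245), §14.14 (p. 243)] [cite: Cassels1965ArithmeticVIII] -/
theorem tameUpperReducibleDefect_body₅ (hmod : exists_isNewformOf)
    (hin : Kato2004.exists_memberHullCountInputs) (hCassels : bsdRHS_eq_of_isIsogenous)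
    (hGZK : rank_eq_analyticRank_of_analyticRank_le_one) (hmodL : hasEntireLFunction_rat) :
    ∀ (W : WeierstrassCurve ℚ) [W.IsElliptic] [W.IsGloballyMinimal] (p : ℕ) [Fact p.Prime],
      W.analyticRank = 0 → p ≠ 2 → Addv W p → SubTprime W p → ¬ W.HasIrreducibleModPGaloisRep p →
      ¬ ((∀ (W' : WeierstrassCurve ℚ) [W'.IsElliptic], IsIsogenous W W' → ¬ p ^ 2 ∣ W'.torsionOrder) ∧
          ∀ q : ℚ, shaAn W = (q : ℂ) → Even (padicValRat p q)) →
      MissingUpperBoundAt W p :=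
  ReducibleUpperOfCountInputs.tameUpperReducibleDefect_body nonempty_iwasawaH1Data_holds hmod hin
    hCassels hGZK hmodL

end Summit.BirchSwinnertonDyer.BirchSwinnertonDyer.Theorems.ReducibleOfTwoInputs

end
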